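import Summits.HodgeConjecture.HodgeConjecture.Theorems.Ring2AbelianAllNonsplitTypeIIWeilClasses
import Literature.AlgebraicGeometry.Milne1999.SpecialLefschetzGroupInvariantsRealMultiplication
import HarnessLib

/-!
# An ANTI-COMPATIBLE algebraic divisor class of non-zero top power makes the Weil classes algebraic
  (WEIL-2 gen 22, door (h′): the rational form of the `V₊`-projection criterion)

research route, not a corollary; conditional on HC_CM plus one named minimal statement.

Cell `pub-hodge-ring2-ab-*` (ALL ABELIAN VARIETIES), seat WEIL-2, generation 22, account
`run/shared/lean/pub/pub-hodge-ring2/pub-hodge-ring2-ab-weil-2/TYPEII-ANCHOR-G22.md` §2.  `HC_CM` does NOT occur;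
no named fact, no `sorry`, no definition.  Sequel of `Ring2AbelianAllNonsplitTypeIIWeilClasses` (the criterion:
`x` algebraic and `(⋀²P₊ x)^{⌣n} ≠ 0` ⟹ `W_K ⊗ ℂ ⊆ Nⁿ`).

THE RATIONAL FORM.  `A` a complex abelian variety of dimension `2n` (`n ≥ 1`), `φ ≫ φ = -(d • 𝟙 A)` (`d ≥ 1`,
`μ = i√d`).  Call a class `x ∈ H²(A(ℂ); ℂ)` ANTI-COMPATIBLE if `φ^*x = -d·x` — the opposite sign to a
`K`-compatible polarization (`φ^*h = +d·h`); equivalently `x ∈ ⋀²V₊ ⊕ ⋀²V₋` has no `V₊ ∧ V₋`-component.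
THEOREM (`cupPowTwo_plusPart_ne_zero_of_anticompatible`): **for an anti-compatible `x` with `x^{⌣2n} ≠ 0` the
`V₊`-part `x₊ = ⋀²P₊ x` has `(x₊)^{⌣n} ≠ 0`**; hence (`weilClassesOf_le_algebraicClasses_of_anticompatible`):
**an ALGEBRAIC anti-compatible degree-two class of non-zero top self-intersection makes every Weil class of
`(A, φ)` algebraic.**  Where such classes live: exactly at the abelian varieties of the Weil component carrying a
Rosati-SYMMETRIC invertible endomorphism `ψ` anticommuting with `φ` (`x = (𝟙+ψ)^*h − h − ψ^*h = 2h(ψ^*·,·)`,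
`x^{2n} = ±4ⁿ·√(det ψ^*)·h^{2n} ≠ 0`, i.e. `(-4b)ⁿ·h^{2n}` when `ψ² = b`): Albert type II, `D = K ⊕ Kψ` an
INDEFINITE quaternion algebra — the
`n(n+1)/2`-dimensional anchor locus `𝔔(D)` of the account (for the cell: `D₆ = (-3,2)_ℚ`, dimension 6 of 9); on
the general member (`NS = ℚh`) and at type-III points (`ψ` Rosati-antisymmetric, `x = 0`) there is none.

PROOF of the theorem (§1–§4).  `x = x₊ + x₋` with `x₋ = ⋀²P₋ x`, `P₋ = (2μ)⁻¹(μ − φ^*)` the complementary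
projector (the degree-two expansion of the tree, `exteriorPullback_two_eq_of_eq_smul_add_smul`, and `φ^*x = -d·x`:
the cross terms cancel, `-4a²d = 1` for `a = (2μ)⁻¹`), §3.  `x₊`, `x₋` are commuting degree-two classes, so
`x^{2n} = (x₊ + x₋)^{2n} = Σ_w ω_w` summed over the `2^{2n}` words `w` in the two letters (the tree's word calculus
`cupPowTwo_sum_eq_sum_wordProd`, `wordProd_comp_perm`, `wordProd_append_eq_zero` of
`Milne1999.SpecialLefschetzGroupInvariantsRealMultiplication`), §4.  A word with at least `n` letters `x₊` is a
permutation of a word beginning with `x₊ⁿ`, which vanishes if `(x₊)^n = 0`; a word with at least `n + 1` letters `x₋`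
begins, after a permutation, with `x₋^{n+1} = ⋀^{2n+2}P₋(x^{n+1}) = 0`, because `⋀^{2n+2}` of a linear map with
values in the `2n`-dimensional `V₋` kills every product of `2n + 2` degree-one classes (alternating, §1
`exteriorPullback_eq_zero_of_finrank_lt`).  Every word of length `2n` is of one of the two kinds (§2, the sorting
permutation `exists_perm_const_front`), so `(x₊)^n = 0` forces `x^{2n} = 0`.

CONTENTS.  §1 `⋀ᵏP = 0` beyond the rank of `P`; §2 words: sorting a letter to the front, constant words are powers,
the vanishing lemma; §3 `x = x₊ + x₋` for anti-compatible `x`; §4 the theorem; §5 the corollary for the Weil classes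
and the literal body of the rung R1′ `WeilTypeLadder.NonsplitSixfolds` on the locus "`(A, φ)` carries an algebraic
anti-compatible class with `x⁶ ≠ 0`" (binders of the rung verbatim, the hyperbolicity one unused) with its on-path
lemma.

HONEST LABEL.  A CASE of R1′ on the type-II sub-locus; fact-free; nothing on the general member; 0 rungs.  In print
the conclusion is Moonen–Zarhin's second criterion / Murty 1988 (module docstring of the prequel).

References: [MoonenZarhin1998WeilClasses] §1–2; [Murty1988] Thm. 2; [vanGeemen1994HodgeAV] 4.8–4.11, 5.2, 6.12;
[Deligne1982HodgeCycles] §4 Rem. 4.10; [Milne1999LefschetzClasses] §3 Prop. 3.6; [HatcherAT2002] §3.2;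
[VoisinHodgeII2003] Prop. 9.20; [Markman2025SurveySecant] §11.5, §12.
-/

noncomputable section

open CategoryTheory
open Literature.AlgebraicGeometry Literature.AlgebraicGeometry.Motives
open Literature.AlgebraicGeometry.HodgeTheory
open Literature.AlgebraicGeometry.Milne1999
open Literature.AlgebraicTopology.SingularHomology

namespace Summit.HodgeConjecture.Ring2AbelianAll.NonsplitTypeIIWeilClasses

variable {A : AbelianVariety ℂ} {φ : A ⟶ A} {n d : ℕ}

/-! ## §1 `⋀ᵏP = 0` on `Hᵏ` when `P` takes values in a subspace of dimension `< k` -/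

/-- **A product of linearly DEPENDENT degree-one classes vanishes** (`H• = ⋀•H¹`: the product is the image of
`v₁ ∧ ⋯ ∧ v_k` under the comparison isomorphism, and `ιMulti` is alternating).  [cite: HatcherAT2002, §3.2 Example 3.16]
[cite: LangeBirkenhake1992, Lemma 1.1.17] -/
theorem cupPowOne_eq_zero_of_not_linearIndependent (A : AbelianVariety ℂ) {k : ℕ}
    {v : Fin k → complexBetti A.X 1} (hv : ¬ LinearIndependent ℂ v) :
    cupPowOne ℂ (Motives.ComplexPoints A.X) k v = 0 := by
  set hΛ := AbelianVariety.hasExteriorCohomologyH1_complexPoints A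
  have h := HasExteriorCohomologyH1.equiv_symm_cupPowOne hΛ k v
  rw [AlternatingMap.map_linearDependent (exteriorPower.ιMulti ℂ k) v hv, LinearEquiv.symm_apply_eq,
    map_zero] at h
  exact h

/-- **`⋀ᵏP (Hᵏ) = 0` if `P : H¹ → H¹` takes values in a subspace `V` with `dim V < k`**: on a generator
`v₁ ⌣ ⋯ ⌣ v_k` the value is `Pv₁ ⌣ ⋯ ⌣ Pv_k`, a product of `k` vectors of `V`, which are linearly dependent.
[cite: HatcherAT2002, §3.2] [cite: LangeBirkenhake1992, Lemma 1.1.17] -/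
theorem exteriorPullback_eq_zero_of_finrank_lt (A : AbelianVariety ℂ)
    {P : complexBetti A.X 1 →ₗ[ℂ] complexBetti A.X 1} {V : Submodule ℂ (complexBetti A.X 1)}
    (hP : ∀ v, P v ∈ V) {k : ℕ} (hk : Module.finrank ℂ V < k) (y : complexBetti A.X k) :
    exteriorPullback (AbelianVariety.hasExteriorCohomologyH1_complexPoints A) P k y = 0 := by
  haveI := finite_complexBetti_abelianVariety A 1
  set hΛ := AbelianVariety.hasExteriorCohomologyH1_complexPoints A
  suffices h : Submodule.span ℂ (Set.range (cupPowOne ℂ (Motives.ComplexPoints A.X) k)) ≤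
      LinearMap.ker (exteriorPullback hΛ P k) by
    have hy : y ∈ Submodule.span ℂ (Set.range (cupPowOne ℂ (Motives.ComplexPoints A.X) k)) := by
      rw [hΛ.span_range_cupPowOne k]
      exact Submodule.mem_top
    exact LinearMap.mem_ker.1 (h hy)
  refine Submodule.span_le.2 ?_
  rintro _ ⟨v, rfl⟩
  rw [SetLike.mem_coe, LinearMap.mem_ker, exteriorPullback_cupPowOne]
  refine cupPowOne_eq_zero_of_not_linearIndependent A fun hli => ?_
  -- the family `i ↦ P (v i)` lies in `V`, of dimension `< k`
  let u : Fin k → V := fun i => ⟨P (v i), hP (v i)⟩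
  have hu : LinearIndependent ℂ u := LinearIndependent.of_comp V.subtype (by exact hli)
  have hcard := hu.fintype_card_le_finrank
  rw [Fintype.card_fin] at hcard
  omega

/-! ## §2 Words in commuting degree-two classes -/

section Words

variable {m : ℕ} (ω : Fin m → complexBetti A.X 2)
  (Y : ∀ q : ℕ, (Fin q → Fin m) → complexBetti A.X (2 * q))
  (hY0 : ∀ w, Y 0 w = singularCohomology.one ℂ (ComplexPoints A.X))
  (hYs : ∀ (q : ℕ) (w : Fin (q + 1) → Fin m),
    Y (q + 1) w = cupProduct (two_mul_add_two q) (Y q (Fin.init w)) (ω (w (Fin.last q))))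
include hY0 hYs

/-- **The product along a constant word is a power**: `Y p (c, …, c) = (ω c)^{⌣p}`.  [cite: HatcherAT2002, §3.2] -/
theorem wordProd_const_eq_cupPowTwo (c : Fin m) : ∀ p : ℕ, Y p (fun _ => c) = cupPowTwo (ω c) p
  | 0 => by rw [hY0, cupPowTwo_zero]
  | p + 1 => by
    rw [hYs, cupPowTwo_succ, ← wordProd_const_eq_cupPowTwo c p]
    rfl

omit hY0 hYs in
/-- **Sorting a letter to the front**: if the letter `c` occurs at least `p` times in a word `w` of length
`p + r`, some permutation of the positions puts `c` in the first `p` places.  [folklore] -/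
theorem exists_perm_const_front {p r : ℕ} (w : Fin (p + r) → Fin m) (c : Fin m)
    (hp : p ≤ (Finset.univ.filter fun i => w i = c).card) :
    ∃ σ : Equiv.Perm (Fin (p + r)), ∀ i : Fin p, w (σ (Fin.castAdd r i)) = c := by
  classical
  set S : Finset (Fin (p + r)) := Finset.univ.filter fun i => w i = c with hS
  obtain ⟨T, hTS, hTcard⟩ := Finset.exists_subset_card_eq hp
  set F : Finset (Fin (p + r)) := Finset.univ.map (Fin.castAddEmb r) with hF
  have hFcard : F.card = p := by
    rw [hF, Finset.card_map, Finset.card_univ, Fintype.card_fin]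
  have hcard : Fintype.card {i // i ∈ F} = Fintype.card {i // i ∈ T} := by
    rw [Fintype.card_coe, Fintype.card_coe, hFcard, hTcard]
  let e : {i // i ∈ F} ≃ {i // i ∈ T} := Fintype.equivOfCardEq hcard
  refine ⟨e.extendSubtype, fun i => ?_⟩
  have hiF : Fin.castAdd r i ∈ F := by
    rw [hF, Finset.mem_map]
    exact ⟨i, Finset.mem_univ _, rfl⟩
  have hmem : e.extendSubtype (Fin.castAdd r i) ∈ T := e.extendSubtype_mem _ hiF
  have hmemS := hTS hmem
  rw [hS, Finset.mem_filter] at hmemS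
  exact hmemS.2

/-- **Vanishing lemma**: if the constant word `cᵖ` has product zero (`(ω c)^p = 0`) and `c` occurs at least `p`
times in `w`, then the product along `w` vanishes (sort the `c`'s to the front: the product along a word does not
depend on the order, and a word beginning with a vanishing word vanishes).  [cite: HatcherAT2002, §3.2 Thm. 3.11]
[cite: Milne1999LefschetzClasses, §3 Prop. 3.6 (a)] -/
theorem wordProd_eq_zero_of_le_count {q : ℕ} (w : Fin q → Fin m) (c : Fin m) {p : ℕ}
    (h0 : cupPowTwo (ω c) p = 0) (hp : p ≤ (Finset.univ.filter fun i => w i = c).card) : Y q w = 0 := by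
  classical
  have hpq : p ≤ q := by
    refine hp.trans ?_
    have := Finset.card_filter_le (Finset.univ : Finset (Fin q)) (fun i => w i = c)
    rwa [Finset.card_univ, Fintype.card_fin] at this
  obtain ⟨r, rfl⟩ := Nat.exists_eq_add_of_le hpq
  obtain ⟨σ, hσ⟩ := exists_perm_const_front w c hp
  rw [← wordProd_comp_perm ω Y hY0 hYs (p + r) w σ]
  -- `w ∘ σ = (c, …, c) ++ v`
  have hsplit : (fun i => w (σ i)) =
      Fin.append (fun _ : Fin p => c) (fun j : Fin r => w (σ (Fin.natAdd p j))) := by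
    have h := (Fin.append_castAdd_natAdd (f := fun i => w (σ i)))
    have hu : (fun i : Fin p => w (σ (Fin.castAdd r i))) = fun _ => c := funext hσ
    rw [hu] at h
    exact h.symm
  rw [hsplit]
  refine wordProd_append_eq_zero ω Y hYs ?_ r _
  rw [wordProd_const_eq_cupPowTwo ω Y hY0 hYs c p, h0]

/-- **Both-sided vanishing for two letters**: for words in two commuting classes `ω₀, ω₁` of length `2n`, if
`ω₀ⁿ = 0` and `ω₁^{n+1} = 0` then every word product of length `2n` vanishes, hence `(ω₀ + ω₁)^{2n} = 0`.
[cite: HatcherAT2002, §3.2] [cite: Milne1999LefschetzClasses, §3 Prop. 3.6 (a)] -/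
theorem cupPowTwo_add_eq_zero_of_pow_eq_zero (hm : m = 2) (n : ℕ) (c₀ c₁ : Fin m) (hc : c₀ ≠ c₁)
    (hall : ∀ c : Fin m, c = c₀ ∨ c = c₁)
    (h₀ : cupPowTwo (ω c₀) n = 0) (h₁ : cupPowTwo (ω c₁) (n + 1) = 0) :
    cupPowTwo (∑ k, ω k) (2 * n) = 0 := by
  classical
  have _ := hm
  rw [cupPowTwo_sum_eq_sum_wordProd ω Y hY0 hYs (2 * n)]
  refine Finset.sum_eq_zero fun w _ => ?_
  -- count the letters of `w`
  have hcount : (Finset.univ.filter fun i => w i = c₀).card +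
      (Finset.univ.filter fun i => w i = c₁).card = 2 * n := by
    have h := Finset.card_filter_add_card_filter_not (s := (Finset.univ : Finset (Fin (2 * n))))
      (fun i => w i = c₀)
    rw [Finset.card_univ, Fintype.card_fin] at h
    have e : (Finset.univ.filter fun i => ¬ w i = c₀) = Finset.univ.filter fun i => w i = c₁ := by
      refine Finset.filter_congr fun i _ => ⟨fun hi => (hall (w i)).resolve_left hi, fun hi => ?_⟩
      rw [hi]
      exact fun h' => hc h'.symm
    rw [e] at h
    exact h
  by_cases hn : n ≤ (Finset.univ.filter fun i => w i = c₀).card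
  · exact wordProd_eq_zero_of_le_count ω Y hY0 hYs w c₀ h₀ hn
  · exact wordProd_eq_zero_of_le_count ω Y hY0 hYs w c₁ h₁ (by omega)

end Words

/-! ## §3 `x = x₊ + x₋` for an anti-compatible class -/

/-- **`⋀²P₊ x + ⋀²P₋ x = x` when `φ^*x = -d·x`** (`P_± = (2μ)⁻¹(±φ^* + μ)`... precisely `P₊ = (2μ)⁻¹(φ^* + μ)`,
`P₋ = (2μ)⁻¹(μ − φ^*)`): by the degree-two expansion `⋀²(aφ^* + b) x = a²φ^*x + b²x + ab·((φ+𝟙)^*x − φ^*x − x)` the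
cross terms cancel and the rest is `2a²(-d)x + 2a²μ²x = -4a²d·x = x` (`a = (2μ)⁻¹`, `μ² = -d`).
[cite: vanGeemen1994HodgeAV, proof of Thm. 6.12] [cite: Deligne1982HodgeCycles, §4 (4.3)–(4.4)] -/
theorem plusPart_add_minusPart_eq (hd : 0 < d)
    {P Q : complexBetti A.X 1 →ₗ[ℂ] complexBetti A.X 1}
    (hP : ∀ v, P v = (2 * (Complex.I * (Real.sqrt d : ℂ)))⁻¹ •
      (complexBetti.map φ.hom.hom.hom 1 v + (Complex.I * (Real.sqrt d : ℂ)) • v))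
    (hQ : ∀ v, Q v = (2 * (Complex.I * (Real.sqrt d : ℂ)))⁻¹ •
      ((Complex.I * (Real.sqrt d : ℂ)) • v - complexBetti.map φ.hom.hom.hom 1 v))
    {x : complexBetti A.X 2} (hx : complexBetti.map φ.hom.hom.hom 2 x = -((d : ℂ) • x)) :
    exteriorPullback (AbelianVariety.hasExteriorCohomologyH1_complexPoints A) P 2 x +
      exteriorPullback (AbelianVariety.hasExteriorCohomologyH1_complexPoints A) Q 2 x = x := by
  set μ : ℂ := Complex.I * (Real.sqrt d : ℂ) with hμ
  set a : ℂ := (2 * μ)⁻¹ with ha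
  have hμ2 : μ ^ 2 = -(d : ℂ) := by rw [hμ, I_mul_sqrt_sq]
  have hμ0 : μ ≠ 0 := I_mul_sqrt_ne_zero hd
  have hd0 : (d : ℂ) ≠ 0 := Nat.cast_ne_zero.2 hd.ne'
  have h1 : ∀ v : complexBetti A.X 1, complexBetti.map (𝟙 A : A ⟶ A).hom.hom.hom 1 v = v :=
    fun v => abelianVariety_map_id_apply (A := A) v
  have hP' : ∀ v, P v = a • complexBetti.map φ.hom.hom.hom 1 v +
      (a * μ) • complexBetti.map (𝟙 A : A ⟶ A).hom.hom.hom 1 v := by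
    intro v; rw [h1, hP v, smul_add, smul_smul]
  have hQ' : ∀ v, Q v = (-a) • complexBetti.map φ.hom.hom.hom 1 v +
      (a * μ) • complexBetti.map (𝟙 A : A ⟶ A).hom.hom.hom 1 v := by
    intro v; rw [h1, hQ v, smul_sub, smul_smul, neg_smul, sub_eq_add_neg, add_comm]
  have hx1 : complexBetti.map (𝟙 A : A ⟶ A).hom.hom.hom 2 x = x := abelianVariety_map_id_apply (A := A) x
  rw [exteriorPullback_two_eq_of_eq_smul_add_smul φ (𝟙 A) a (a * μ) hP' x,
    exteriorPullback_two_eq_of_eq_smul_add_smul φ (𝟙 A) (-a) (a * μ) hQ' x, hx, hx1]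
  -- collect: the cross terms cancel, the rest is `(2a²(-d) + 2(aμ)²) • x`
  have key : (2 * (a ^ 2 * (-(d : ℂ))) + 2 * (a * μ) ^ 2) = 1 := by
    have ha2 : a ^ 2 = ((2 : ℂ) ^ 2)⁻¹ * (μ ^ 2)⁻¹ := by rw [ha, mul_inv, mul_pow, inv_pow, inv_pow]
    rw [mul_pow, ha2, hμ2]
    field_simp
    ring
  set z := complexBetti.map (φ + 𝟙 A).hom.hom.hom 2 x with hz
  have e : a ^ 2 • -((d : ℂ) • x) + (a * μ) ^ 2 • x + (a * (a * μ)) • (z - -((d : ℂ) • x) - x) +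
      ((-a) ^ 2 • -((d : ℂ) • x) + (a * μ) ^ 2 • x + (-a * (a * μ)) • (z - -((d : ℂ) • x) - x)) =
      (2 * (a ^ 2 * (-(d : ℂ))) + 2 * (a * μ) ^ 2) • x := by
    module
  rw [e, key, one_smul]

/-- **`φ^*(P₋ v) = -μ · P₋ v`** for `P₋ = (2μ)⁻¹(μ − φ^*)`.  [cite: vanGeemen1994HodgeAV, proof of Lemma 5.2] -/
theorem map_minusProj_mem_eigenspace (hφ : φ ≫ φ = -(d • 𝟙 A))
    {Q : complexBetti A.X 1 →ₗ[ℂ] complexBetti A.X 1}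
    (hQ : ∀ v, Q v = (2 * (Complex.I * (Real.sqrt d : ℂ)))⁻¹ •
      ((Complex.I * (Real.sqrt d : ℂ)) • v - complexBetti.map φ.hom.hom.hom 1 v))
    (v : complexBetti A.X 1) :
    Q v ∈ Module.End.eigenspace (complexBetti.map φ.hom.hom.hom 1).hom (-(Complex.I * (Real.sqrt d : ℂ))) := by
  set μ : ℂ := Complex.I * (Real.sqrt d : ℂ) with hμ
  set F : Module.End ℂ (complexBetti A.X 1) := (complexBetti.map φ.hom.hom.hom 1).hom with hF
  have hμ2 : μ * μ = -(d : ℂ) := by rw [← pow_two, hμ, I_mul_sqrt_sq]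
  have hFF : F (F v) = -((d : ℂ) • v) := complexBetti_map_map_one_of_comp_self hφ v
  rw [Module.End.mem_eigenspace_iff]
  have hQv : Q v = (2 * μ)⁻¹ • (μ • v - F v) := hQ v
  rw [hQv, map_smul, map_sub, map_smul, hFF]
  have e : μ • F v - -((d : ℂ) • v) = (-μ) • (μ • v - F v) := by
    have e' : (-μ) • (μ • v - F v) = -((μ * μ) • v) + μ • F v := by module
    rw [e', hμ2, neg_smul, neg_neg, sub_neg_eq_add, add_comm]
  rw [e, smul_comm]

/-! ## §4 The theorem: `x^{2n} ≠ 0`, `φ^*x = -d·x` ⟹ `(x₊)^n ≠ 0` -/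

/-- **An anti-compatible class with non-zero top power has `(⋀²P₊ x)^{⌣n} ≠ 0`.**  `A` of dimension `2n`,
`φ ≫ φ = -(d • 𝟙 A)` (`d ≥ 1`), `P = (2μ)⁻¹(φ^* + μ)` on `H¹`, `x ∈ H²(A(ℂ); ℂ)` with `φ^*x = -d·x` and
`x^{⌣2n} ≠ 0`.  Then `(⋀²P x)^{⌣n} ≠ 0`.  (Word calculus in the two commuting classes `x₊`, `x₋ = ⋀²P₋x` with
`x₊ + x₋ = x`: `x₋^{n+1} = ⋀^{2n+2}P₋(x^{n+1}) = 0` by the rank of `P₋`; if also `x₊^n = 0`, every word of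
length `2n` vanishes, so `x^{2n} = 0`.)  [cite: vanGeemen1994HodgeAV, 4.9 and proof of Thm. 6.12]
[cite: Milne1999LefschetzClasses, §3 Prop. 3.6 (a)] [cite: HatcherAT2002, §3.2] -/
theorem cupPowTwo_plusPart_ne_zero_of_anticompatible (hd : 0 < d) (hA : A.dim = 2 * n)
    (hφ : φ ≫ φ = -(d • 𝟙 A))
    {P : complexBetti A.X 1 →ₗ[ℂ] complexBetti A.X 1}
    (hP : ∀ v, P v = (2 * (Complex.I * (Real.sqrt d : ℂ)))⁻¹ •
      (complexBetti.map φ.hom.hom.hom 1 v + (Complex.I * (Real.sqrt d : ℂ)) • v))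
    {x : complexBetti A.X 2} (hx : complexBetti.map φ.hom.hom.hom 2 x = -((d : ℂ) • x))
    (htop : cupPowTwo x (2 * n) ≠ 0) :
    cupPowTwo (exteriorPullback (AbelianVariety.hasExteriorCohomologyH1_complexPoints A) P 2 x) n ≠ 0 := by
  classical
  intro h0
  apply htop
  set hΛ := AbelianVariety.hasExteriorCohomologyH1_complexPoints A
  haveI := finite_complexBetti_abelianVariety A 1
  -- the complementary projector `P₋`
  let Q : complexBetti A.X 1 →ₗ[ℂ] complexBetti A.X 1 :=
    (2 * (Complex.I * (Real.sqrt d : ℂ)))⁻¹ •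
      ((Complex.I * (Real.sqrt d : ℂ)) • LinearMap.id - (complexBetti.map φ.hom.hom.hom 1).hom)
  have hQ : ∀ v, Q v = (2 * (Complex.I * (Real.sqrt d : ℂ)))⁻¹ •
      ((Complex.I * (Real.sqrt d : ℂ)) • v - complexBetti.map φ.hom.hom.hom 1 v) := fun v => rfl
  set xp := exteriorPullback hΛ P 2 x with hxp
  set xm := exteriorPullback hΛ Q 2 x with hxm
  have hsum : xp + xm = x := plusPart_add_minusPart_eq hd hP hQ hx
  -- `x₋^{n+1} = 0`: `⋀^{2(n+1)} P₋ = 0` since `P₋` takes values in `V₋`, of dimension `2n`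
  have hb₁ : Module.finrank ℂ (complexBetti A.X 1) = 2 * (2 * n) := by
    rw [AbelianVariety.finrank_complexBetti_one, hA]
  have hVm : Module.finrank ℂ (Module.End.eigenspace (complexBetti.map φ.hom.hom.hom 1).hom
      (-(Complex.I * (Real.sqrt d : ℂ)))) = 2 * n := by
    have h := two_mul_finrank_eigenspace_eq hd hφ
    rw [finrank_eigenspace_eq_finrank_eigenspace_neg hd hφ, hb₁] at h
    omega
  have hm1 : cupPowTwo xm (n + 1) = 0 := by
    rw [hxm, ← exteriorPullback_cupPowTwo hΛ Q x (n + 1)]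
    exact exteriorPullback_eq_zero_of_finrank_lt A
      (V := Module.End.eigenspace (complexBetti.map φ.hom.hom.hom 1).hom (-(Complex.I * (Real.sqrt d : ℂ))))
      (fun v => map_minusProj_mem_eigenspace hφ hQ v) (by rw [hVm]; omega) _
  -- words in the two letters `xp`, `xm`
  let ω : Fin 2 → complexBetti A.X 2 := ![xp, xm]
  let Y : ∀ q : ℕ, (Fin q → Fin 2) → complexBetti A.X (2 * q) := fun q =>
    Nat.rec (motive := fun q => (Fin q → Fin 2) → complexBetti A.X (2 * q))
      (fun _ => singularCohomology.one ℂ (ComplexPoints A.X))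
      (fun q ih w => cupProduct (two_mul_add_two q) (ih (Fin.init w)) (ω (w (Fin.last q)))) q
  have hY0 : ∀ w, Y 0 w = singularCohomology.one ℂ (ComplexPoints A.X) := fun w => rfl
  have hYs : ∀ (q : ℕ) (w : Fin (q + 1) → Fin 2),
      Y (q + 1) w = cupProduct (two_mul_add_two q) (Y q (Fin.init w)) (ω (w (Fin.last q))) := fun q w => rfl
  have hsum' : ∑ k, ω k = x := by
    rw [Fin.sum_univ_two]
    exact hsum
  rw [← hsum']
  refine cupPowTwo_add_eq_zero_of_pow_eq_zero ω Y hY0 hYs rfl n 0 1 Fin.zero_ne_one (fun c => ?_) ?_ ?_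
  · exact Fin.exists_fin_two.mp ⟨c, rfl⟩
  · exact h0
  · exact hm1

/-! ## §5 The Weil classes; the rung R1′ on the anti-compatible locus -/

/-- **AN ALGEBRAIC ANTI-COMPATIBLE DEGREE-TWO CLASS OF NON-ZERO TOP POWER MAKES THE WEIL CLASSES ALGEBRAIC.**
`A` of dimension `2n` (`n ≥ 1`), `φ ≫ φ = -(d • 𝟙 A)` (`d ≥ 1`, `K = ℚ(√-d)`); `x ∈ H²(A(ℂ); ℂ)` algebraic with
`φ^*x = -d·x` and `x^{⌣2n} ≠ 0`.  Then `weilClassesOf A φ n d ≤ algebraicClasses A.X n`.  (§4 + the criterion of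
the prequel.)  The hypothesis holds on the type-II loci `𝔔(D)` (Rosati-symmetric invertible `ψ` anticommuting with
`φ`: `x = (𝟙+ψ)^*h − h − ψ^*h`), and nowhere on the general member or at type-III points (account §2–§3).
[cite: MoonenZarhin1998WeilClasses, §1–2 (second criterion)] [cite: Murty1988, Thm. 2]
[cite: vanGeemen1994HodgeAV, 4.8–4.11, 6.12] [cite: VoisinHodgeII2003, Prop. 9.20] -/
theorem weilClassesOf_le_algebraicClasses_of_anticompatible (hn : 0 < n) (hd : 0 < d) (hA : A.dim = 2 * n)
    (hφ : φ ≫ φ = -(d • 𝟙 A)) {x : complexBetti A.X 2} (hxalg : x ∈ algebraicClasses A.X 1)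
    (hx : complexBetti.map φ.hom.hom.hom 2 x = -((d : ℂ) • x)) (htop : cupPowTwo x (2 * n) ≠ 0) :
    weilClassesOf A φ n d ≤ algebraicClasses A.X n := by
  let P : complexBetti A.X 1 →ₗ[ℂ] complexBetti A.X 1 :=
    (2 * (Complex.I * (Real.sqrt d : ℂ)))⁻¹ •
      ((complexBetti.map φ.hom.hom.hom 1).hom + (Complex.I * (Real.sqrt d : ℂ)) • LinearMap.id)
  have hP : ∀ v, P v = (2 * (Complex.I * (Real.sqrt d : ℂ)))⁻¹ •
      (complexBetti.map φ.hom.hom.hom 1 v + (Complex.I * (Real.sqrt d : ℂ)) • v) := fun v => rfl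
  exact weilClassesOf_le_algebraicClasses_of_plusPart_pow_ne_zero hn hd hA hφ hP hxalg
    (cupPowTwo_plusPart_ne_zero_of_anticompatible hd hA hφ hP hx htop)

open Summit.HodgeConjecture.HodgeConjecture.WeilTypeLadder in
/-- **The literal body of R1′ (`WeilTypeLadder.NonsplitSixfolds`) ON THE ANTI-COMPATIBLE LOCUS**: non-split
Weil sixfolds `(A, φ)` carrying an algebraic class `x ∈ H²` with `φ^*x = -d·x` and `x⁶ ≠ 0` — e.g. every member
of the 6-dimensional type-II family `𝔔(D₆)` of the `(ℚ(√-3), (3,3), δ = 2)` cell (account §1–§3; the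
verification `x⁶ ≠ 0` there is on paper: `x = 2h(β^*·,·)`, `x⁶ = (-4·2)³ h⁶ = -512 h⁶` — the model's
`b⁶ = -8u⁶` for `b = h(β^*·,·)`, `β² = 2`).  Rung binders verbatim, the
hyperbolicity one unused; fact-free.  [cite: Markman2025SurveySecant, §11.5 Step 1 and §12]
[cite: MoonenZarhin1998WeilClasses, §2] -/
theorem nonsplitSixfolds_of_anticompatible :
    ∀ (d : ℕ), 0 < d → ∀ (A : Motives.AbelianVariety ℂ) (φ : A ⟶ A), A.dim = 2 * 3 →
      Motives.IsSmoothProjective (2 * 3) A.X → φ ≫ φ = -(d • 𝟙 A) →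
        (∀ (e : Motives.ProjectiveEmbedding A.X) (a : complexBetti (Motives.projectiveSpace e.n ℂ) 2),
          IsRationalClass a → a ≠ 0 →
            ¬ Motives.IsHyperbolicWeilType A φ 3
              ((d : ℂ) • complexBetti.map e.ι 2 a +
                complexBetti.map φ.hom.hom.hom 2 (complexBetti.map e.ι 2 a))) →
        (∃ x : complexBetti A.X 2, x ∈ algebraicClasses A.X 1 ∧
          complexBetti.map φ.hom.hom.hom 2 x = -((d : ℂ) • x) ∧ cupPowTwo x (2 * 3) ≠ 0) →
        ∀ c : complexBetti A.X (2 * 3), IsRationalClass c → IsOfHodgeType (2 * 3) A.X (2 * 3) 3 3 c →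
          c ∈ weilClassesOf A φ 3 d → c ∈ algebraicClasses A.X 3 := by
  intro d hd A φ hA _ hφ _ hloc c _ _ hc
  obtain ⟨x, hxalg, hx, htop⟩ := hloc
  exact weilClassesOf_le_algebraicClasses_of_anticompatible (n := 3) (by norm_num) hd hA hφ hxalg hx htop hc

open Summit.HodgeConjecture.HodgeConjecture.WeilTypeLadder in
/-- **ON PATH**: the anti-compatible locus statement is a CASE of R1′ (drop the locus hypothesis), hence of the
summit (`WeilTypeLadder.nonsplitSixfolds_of_hodgeConjecture`).  Bookkeeping only.  [cite: Markman2025SurveySecant, §12] -/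
theorem nonsplitSixfolds_of_anticompatible_of_nonsplitSixfolds (h : NonsplitSixfolds) :
    ∀ (d : ℕ), 0 < d → ∀ (A : Motives.AbelianVariety ℂ) (φ : A ⟶ A), A.dim = 2 * 3 →
      Motives.IsSmoothProjective (2 * 3) A.X → φ ≫ φ = -(d • 𝟙 A) →
        (∀ (e : Motives.ProjectiveEmbedding A.X) (a : complexBetti (Motives.projectiveSpace e.n ℂ) 2),
          IsRationalClass a → a ≠ 0 →
            ¬ Motives.IsHyperbolicWeilType A φ 3
              ((d : ℂ) • complexBetti.map e.ι 2 a +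
                complexBetti.map φ.hom.hom.hom 2 (complexBetti.map e.ι 2 a))) →
        (∃ x : complexBetti A.X 2, x ∈ algebraicClasses A.X 1 ∧
          complexBetti.map φ.hom.hom.hom 2 x = -((d : ℂ) • x) ∧ cupPowTwo x (2 * 3) ≠ 0) →
        ∀ c : complexBetti A.X (2 * 3), IsRationalClass c → IsOfHodgeType (2 * 3) A.X (2 * 3) 3 3 c →
          c ∈ weilClassesOf A φ 3 d → c ∈ algebraicClasses A.X 3 :=
  fun d hd A φ hA hX hφ hnh _ c hcQ hct hc => h d hd A φ hA hX hφ hnh c hcQ hct hc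

end Summit.HodgeConjecture.Ring2AbelianAll.NonsplitTypeIIWeilClasses

end
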